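/-
COR-CM (cell pub-hodgecm2, stage 2 of the Hodge ladder) — TRANSPOSITION SURGE, item (vi) pinning record, binder `hComp`
(REACH half), TEAM hComp, Shimura-datum / canonical-model record side (seat hcomp-shimura, gen 13).  KERNEL WITNESS for
the red-team item «T5 witness for `exists_recordSystem` v5» (TGTBT D9.3 item 3): the COMPLEX-GEOMETRIC clauses of Deligne's
canonical-model record (`UnitaryCanonicalModel.ComplexRecord` of `UnitaryShimuraComplexRecord`) are SATISFIABLE AT EVERY DATUM
— the complex model `∐_q X_q` is assembled from the tree's compact ball quotients (`PicardCM.BallQuotientUniformised`, a theorem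
of the tree: `BallQuotient.ballQuotientUniformisedDatum_holds`).  THEOREMS ONLY: no definition, no instance, no named fact,
nothing asserted; every landed file untouched.  FRAMING: HC_CM is NOT proved; nothing here discharges `hComp`/`h`.
-/
import Summits.HodgeConjecture.CorCM.B01.Transposition.HComp.PiecesOfRecord
import Summits.HodgeConjecture.CorCM.B01.Transposition.HComp.RecordSystemOfFields
import Summits.HodgeConjecture.CorCM.Geometry.BallQuotientUniformisedHolds
import Literature.AlgebraicGeometry.ShimuraVarieties.UnitaryShimuraComplexRecord
import Literature.AlgebraicGeometry.ShimuraVarieties.UnitaryShimuraHeckeComplex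
import Literature.AlgebraicGeometry.Motives.FiniteCoproductVarieties
import Literature.NumberTheory.Transcendental.AnalytificationFunctorialityProofs
import HarnessLib

/-!
# The complex record of `Sh_K(U(H), 𝔹²)` is inhabited at every datum: the complex model `∐_q X_q` from the pieces

Main result (namespace `Summit.HodgeConjecture.CorCM.HComp`):

* **`nonempty_complexRecord`** — for a CM field `L`, `H ∈ M₃(L)` with a frame `Tᴴ H^τ T = diag(1,1,-1)` at `τ`,
  positive definite at the complex embeddings off the place of `τ`, anisotropic, and `K ≤ U(H)(𝔸_{L⁺,f})` compact open
  all of whose conjugate arithmetic levels `Γ_H(gKg⁻¹)` are torsion-free — EXACTLY the hypotheses of the named fact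
  `UnitaryCanonicalModel.exists_recordSystem` ([Deligne1979ShimuraVarieties] 2.2.5 + Cor. 2.7.21) read at one level — the
  structure `UnitaryCanonicalModel.ComplexRecord L H τ T hT K` (the complex-geometric clauses (C1) smooth projective / (C2a)
  `pts` / (C2b) `hol` / (C2c) `pieces` of Deligne's record, VERBATIM with a complex scheme in place of `M ⊗_{L,τ} ℂ`) is
  INHABITED.  Construction ([Deligne1979ShimuraVarieties] 2.1.2 «`_K M_ℂ(G,X)` … is a disjoint sum, indexed by
  `G(ℚ)\G(𝔸^f)/K`, of the quotients `Γ_g \ X⁺`»; [Milne2005ShimuraVarieties] Lemma 5.13): choose representatives `g_q` of the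
  finite set `Ξ_K` (`finite_shimuraIndex`); for each `q` the natural level `Γ_q = U(H)(L⁺) ∩ g_qKg_q⁻¹` is a torsion-free
  congruence subgroup, so the tree's theorem `BallQuotientUniformisedDatum` (`ballQuotientUniformisedDatum_holds`, applied
  to the Picard code `PicardCode.ofHermitian τ H Γ_q`) provides a smooth projective surface `X_q/ℂ` with a ball
  uniformisation datum of Gram matrix `H^τ` and group `τ(Γ_q)`; the complex model is `Mc := ∐_q X_q` (a colimit cofan in
  `SchemeOver ℂ`; smooth and projective by `Motives/FiniteCoproductVarieties`); its complex points are
  `⨆_q X_q(ℂ) ≃ₜ ⨆_q Δ(Γ_q)\𝔹² ≃ₜ Sh_K(ℂ)` (`exists_pieceHomeomorph_of_datum` below + the tree's dissection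
  `UnitaryGroup.shimuraSetHomeomorph`); `hol` holds because `[z, aK] = [ρ(γ)z, g_qK]` for a rational `γ`
  (`UnitaryCanonicalModel.exists_rational_rep`) and the uniformisations are holomorphic in algebraic coordinates on ALL opens
  (`differentiableOn_evalOrZero_unif`: the datum's affine clause is local); `pieces` is the cofan itself.
* `exists_pieceHomeomorph_of_datum` — a ball datum on `X` with Gram matrix `H^τ` and group `τ(Γ)`, `Γ ≤ U(H)(L⁺)`, gives
  `X(ℂ) ≃ₜ Δ(Γ)\𝔹²` (`Δ(Γ) = T⁻¹Γ^τT`, the tree's `archImageU21`) with `[z] ↦ unif(T·(z,1))`.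
* `differentiableOn_evalOrZero_unif` — the uniformisation of a ball datum is holomorphic in the algebraic coordinates of
  EVERY open (not only affine ones).

Consequence for the record (see `UnitaryShimuraComplexRecord`): `Record L H τ T hT K → ComplexRecord L H τ T hT K` is the
tree's `Record.complexRecord`, and `ComplexRecord L H τ T hT K` is inhabited here WITHOUT any named fact; so what
`exists_recordSystem` asserts beyond the tree's own theorems is exactly its arithmetic part — an `L`-form of this complex
model, natural in the level, with Shimura reciprocity (62) at the diagonal special pairs ([Deligne1979ShimuraVarieties]
2.2.5 «a form over `E(G,X)` of `M_ℂ(G,X)` equipped with … an equivariant isomorphism», 2.2.4).  0 hypothesis binders of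
Prop-valued named facts (T5: n/a).  HC_CM is NOT proved; S2 is not closed by anything here.

References: P. Deligne, *Variétés de Shimura*, Proc. Symp. Pure Math. 33.2 (1979), 2.1.2–2.1.4, 2.2.5, Cor. 2.7.21;
J. S. Milne, *Introduction to Shimura varieties* (2005/2017), Lemma 5.13; N. Bergeron, J. Millson, C. Moeglin, Acta Math. 216
(2016), Introduction §1.1, Part 2 §§1.1–1.4; A. Grothendieck, M. Raynaud, SGA 1, Exp. XII, Prop. 3.1 (xi); I. R. Shafarevich,
*Basic Algebraic Geometry 2*, IX §3.2 (the tree's `compactBallQuotient_projectiveEmbedding_holds`).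
-/

set_option autoImplicit false

noncomputable section

open scoped Matrix Topology ComplexOrder
open Set Function MulAction Matrix NumberField CategoryTheory CategoryTheory.Limits AlgebraicGeometry Opposite
open Literature.Geometry.ComplexHyperbolic
open Literature.Geometry.ComplexHyperbolic.BallModel (U21 Ball proj lift mat x₀)
open Literature.NumberTheory.Automorphic
open Literature.NumberTheory.Automorphic.UnitaryGroup
open Literature.NumberTheory.Automorphic.ShimuraDissection (CosetSpace sigmaCongrRightHomeomorph)
open Literature.NumberTheory.Automorphic.PicardCM (PicardCode pmsRealisation)
open Literature.AlgebraicGeometry.ShimuraVarieties (negCone hermForm UnitaryBallUniformisationDatum IsCongruenceSubgroup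
  isOpen_negCone signatureMatrix unitaryGroup_eq_unitaryGroupOfForm)
open Literature.AlgebraicGeometry.ShimuraVarieties.UnitaryCanonicalModel (Record ComplexRecord mulVec_frame_lift_ratToU21_smul)
open Literature.AlgebraicGeometry.Motives (SchemeOver ComplexPoints AlgPoints IsSmoothProjective IsProjectiveOver)
open Summit.HodgeConjecture.CorCM.FramedCone

namespace Summit.HodgeConjecture.CorCM.HComp

variable (L : Type) [Field L] [NumberField L] [IsCMField L] (H : Matrix (Fin 3) (Fin 3) L)
  (τ : L →+* ℂ) (T : GL (Fin 3) ℂ) (hT : formCongr (starRingEnd ℂ) T (H.map τ) = BallModel.J)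

/-! ## 1. The uniformisation of a ball datum is holomorphic in the algebraic coordinates of EVERY open -/

/-- **Holomorphy of `unif` on all opens.**  For a ball datum `D` on `X/ℂ`, an arbitrary open `W ⊆ X` and `s ∈ Γ(X, W)`,
`v ↦ s(unif v)` is complex differentiable on the part of the negative cone above `W` (the datum's clause
`differentiableOn_unif` is stated for AFFINE opens; affine opens form a basis, evaluation is compatible with restriction —
the tree's `AlgPoints.evalOrZero_map_homOfLE` — and differentiability is local; the relevant sets are open because `unif`
is continuous on the open cone and `W(ℂ) ⊆ X(ℂ)` is open, `AlgPoints.isOpen_setOf_pt_mem`).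
[cite: BergeronMillsonMoeglin2016Balls, Introduction §1.1 and Part 2 §1.3] -/
theorem differentiableOn_evalOrZero_unif {X : SchemeOver ℂ} {p : ℕ} (D : UnitaryBallUniformisationDatum p X)
    (W : X.left.Opens) (s : X.left.presheaf.obj (op W)) :
    DifferentiableOn ℂ (fun v ↦ AlgPoints.evalOrZero W s (D.unif v)) (D.cone ∩ D.unif ⁻¹' {P | P.pt ∈ W}) := by
  rintro w₀ ⟨hw₀c, hw₀W⟩
  obtain ⟨V, hV, hPV, hVW⟩ := (TopologicalSpace.Opens.isBasis_iff_nbhd.mp X.left.isBasis_affineOpens) hw₀W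
  have hd := D.differentiableOn_unif ⟨V, hV⟩ (X.left.presheaf.map (homOfLE hVW).op s)
  have hopen : IsOpen (D.cone ∩ D.unif ⁻¹' {P | P.pt ∈ V}) :=
    D.continuousOn_unif.isOpen_inter_preimage (isOpen_negCone _) (AlgPoints.isOpen_setOf_pt_mem V)
  have hmem : w₀ ∈ D.cone ∩ D.unif ⁻¹' {P | P.pt ∈ V} := ⟨hw₀c, hPV⟩
  have hAt : DifferentiableAt ℂ
      (fun v ↦ AlgPoints.evalOrZero V (X.left.presheaf.map (homOfLE hVW).op s) (D.unif v)) w₀ :=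
    (hd w₀ hmem).differentiableAt (hopen.mem_nhds hmem)
  refine (hAt.congr_of_eventuallyEq ?_).differentiableWithinAt
  filter_upwards [hopen.mem_nhds hmem] with v hv
  exact (AlgPoints.evalOrZero_map_homOfLE hVW s hv.2).symm

/-! ## 2. The complex points of a ball datum with Gram matrix `H^τ` and group `τ(Γ)` are the ball quotient `Δ(Γ)\𝔹²` -/

/-- **`X(ℂ) ≃ₜ Δ(Γ)\𝔹²` for a ball datum of Gram matrix `H^τ` and group `τ(Γ)`**, `Γ ≤ U(H)(L⁺)`, `Δ(Γ) = T⁻¹Γ^τT` the tree's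
`UnitaryGroup.archImageU21`, normalised by `[z] ↦ unif (T·(z,1))`: both `X(ℂ)` (fields `continuousOn_unif`, `isOpenMap_unif`,
`surjOn_unif`, `unif_eq_unif_iff` of the datum) and `Δ(Γ)\𝔹²` (the framed cone chart `FramedCone.coneChart`, open continuous
onto, fibres `pieceProj_eq_iff`) are quotients of the negative cone of `H^τ` by the `Γ·ℂˣ`-orbits.
[cite: BergeronMillsonMoeglin2016Balls, Introduction §1.1 and Part 2 §1.3] [cite: Milne2005ShimuraVarieties, Lemma 5.13 p. 57] -/
theorem exists_pieceHomeomorph_of_datum {Γ : Subgroup (GL (Fin 3) L)}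
    (hΓ : Γ ≤ rational (↥(maximalRealSubfield L)) L (IsCMField.complexConj L) 3 H)
    {X : SchemeOver ℂ} (D : UnitaryBallUniformisationDatum 2 X) (hHc : D.Hℂ = H.map τ)
    (hΓc : D.Γ.map (Matrix.GeneralLinearGroup.map (D.τ₁ : ↥D.E →+* ℂ)) = Γ.map (Matrix.GeneralLinearGroup.map τ)) :
    ∃ φ : ComplexPoints X ≃ₜ orbitRel.Quotient (archImageU21 L H τ T hT Γ) Ball,
      ∀ z : Ball, φ.symm (Quotient.mk'' z) = D.unif ((T : Matrix (Fin 3) (Fin 3) ℂ) *ᵥ lift z) := by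
  classical
  have hJ := frame_J_of_formCongr L H τ T hT
  have hcone : D.cone = negCone (H.map τ) := congrArg negCone hHc
  -- the datum's clauses, on the negative cone of `H^τ`
  have hcont : ContinuousOn D.unif (negCone (H.map τ)) := hcone ▸ D.continuousOn_unif
  have hopenr : IsOpenMap ((negCone (H.map τ)).restrict D.unif) := by rw [← hcone]; exact D.isOpenMap_unif
  have hsurj : Set.SurjOn D.unif (negCone (H.map τ)) Set.univ := hcone ▸ D.surjOn_unif
  have hfib : ∀ v ∈ negCone (H.map τ), ∀ w ∈ negCone (H.map τ),
      D.unif v = D.unif w ↔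
        ∃ γ ∈ Γ, ∃ c : ℂ, c ≠ 0 ∧ ((γ : Matrix (Fin 3) (Fin 3) L).map τ) *ᵥ v = c • w := by
    intro v hv w hw
    have hv' : v ∈ D.cone := hcone ▸ hv
    have hw' : w ∈ D.cone := hcone ▸ hw
    rw [D.unif_eq_unif_iff v hv' w hw',
      exists_mem_map_matrix_iff (D.τ₁ : ↥D.E →+* ℂ) D.Γ (fun g => ∃ c : ℂ, c ≠ 0 ∧ g *ᵥ v = c • w), hΓc,
      ← exists_mem_map_matrix_iff τ Γ (fun g => ∃ c : ℂ, c ≠ 0 ∧ g *ᵥ v = c • w)]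
  have hsmul : ∀ v ∈ negCone (H.map τ), ∀ c : ℂ, c ≠ 0 → D.unif (c • v) = D.unif v := by
    intro v hv c hc
    exact (hfib (c • v) (Literature.AlgebraicGeometry.ShimuraVarieties.smul_mem_negCone hc hv) v hv).2
      ⟨1, one_mem _, c, hc, by simp⟩
  -- `[z] = [z'] ↔ unif (T·(z,1)) = unif (T·(z',1))`
  have key : ∀ a b : Ball,
      (Quotient.mk'' a : orbitRel.Quotient (archImageU21 L H τ T hT Γ) Ball) = Quotient.mk'' b ↔
        D.unif ((T : Matrix (Fin 3) (Fin 3) ℂ) *ᵥ lift a) = D.unif ((T : Matrix (Fin 3) (Fin 3) ℂ) *ᵥ lift b) := by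
    intro a b
    have h := pieceProj_eq_iff L H τ T hT hΓ (coneLift T hJ a) (coneLift T hJ b)
    rw [coneChart_coneLift, coneChart_coneLift] at h
    rw [h, hfib _ (t_mulVec_lift_mem T hJ a) _ (t_mulVec_lift_mem T hJ b)]
    exact Iff.rfl
  -- the comparison map `ψ : Δ(Γ)\𝔹² → X(ℂ)`
  let f : Ball → ComplexPoints X := fun z => D.unif ((T : Matrix (Fin 3) (Fin 3) ℂ) *ᵥ lift z)
  have hf : ∀ a b : Ball, (MulAction.orbitRel (archImageU21 L H τ T hT Γ) Ball) a b → f a = f b :=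
    fun a b hab => (key a b).mp (Quotient.sound hab)
  let ψ : orbitRel.Quotient (archImageU21 L H τ T hT Γ) Ball → ComplexPoints X := Quotient.lift f hf
  have hψmk : ∀ z : Ball, ψ (Quotient.mk'' z) = f z := fun z => rfl
  -- `unif v = ψ [coneChart v]`
  have hψchart : ∀ v : negCone (H.map τ), D.unif (v : Fin 3 → ℂ) = ψ (Quotient.mk'' (coneChart T hJ v)) := by
    intro v
    have h2 : ((ti T *ᵥ (v : Fin 3 → ℂ)) 2) ≠ 0 := BallModel.ne_zero_of_Q_neg (Q_ti_mulVec_neg T hJ v.2)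
    rw [hψmk]
    change D.unif (v : Fin 3 → ℂ) = D.unif ((T : Matrix (Fin 3) (Fin 3) ℂ) *ᵥ lift (coneChart T hJ v))
    conv_lhs => rw [← smul_t_mulVec_lift_coneChart T hJ v]
    exact hsmul _ (t_mulVec_lift_mem T hJ _) _ h2
  have hinj : Injective ψ := by
    intro x y hxy
    induction x using Quotient.inductionOn' with
    | h a =>
      induction y using Quotient.inductionOn' with
      | h b => exact (key a b).mpr hxy
  have hsur : Surjective ψ := by
    intro P
    obtain ⟨v, hv, rfl⟩ := hsurj (Set.mem_univ P)
    exact ⟨Quotient.mk'' (coneChart T hJ ⟨v, hv⟩), (hψchart ⟨v, hv⟩).symm⟩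
  have hfcont : Continuous f :=
    hcont.comp_continuous (continuous_const.matrix_mulVec (continuous_ballLift)) fun z => t_mulVec_lift_mem T hJ z
  have hψcont : Continuous ψ := hfcont.quotient_lift hf
  -- `ψ` is open: `ψ(O) = unif(negCone ∩ pr⁻¹ O)` for the continuous projection `pr v = [coneChart v]`
  let pr : negCone (H.map τ) → orbitRel.Quotient (archImageU21 L H τ T hT Γ) Ball :=
    fun v => Quotient.mk'' (coneChart T hJ v)
  have hpr : Continuous pr := continuous_quotient_mk'.comp (continuous_coneChart T hJ)
  have hψopen : IsOpenMap ψ := by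
    intro O hO
    have hset : ψ '' O = ((negCone (H.map τ)).restrict D.unif) '' (pr ⁻¹' O) := by
      ext P
      constructor
      · rintro ⟨x, hx, rfl⟩
        induction x using Quotient.inductionOn' with
        | h z =>
          refine ⟨coneLift T hJ z, ?_, ?_⟩
          · change Quotient.mk'' (coneChart T hJ (coneLift T hJ z)) ∈ O
            rw [coneChart_coneLift]; exact hx
          · rfl
      · rintro ⟨v, hv, rfl⟩
        exact ⟨pr v, hv, (hψchart v).symm⟩
    rw [hset]
    exact hopenr _ (hO.preimage hpr)
  let e : orbitRel.Quotient (archImageU21 L H τ T hT Γ) Ball ≃ₜ ComplexPoints X :=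
    (Equiv.ofBijective ψ ⟨hinj, hsur⟩).toHomeomorphOfContinuousOpen hψcont hψopen
  exact ⟨e.symm, fun z => rfl⟩

/-! ## 3. The complex record is inhabited at every datum -/

set_option maxHeartbeats 800000 in -- large adelic / Shimura-set terms: instance-heavy statement and construction
/-- **The complex-geometric clauses of Deligne's canonical-model record are jointly satisfiable at every datum** (the
KERNEL WITNESS for the red-team item «T5 witness for `exists_recordSystem`»).  Under EXACTLY the hypotheses of the named fact
`UnitaryCanonicalModel.exists_recordSystem` read at one level — `H` with a frame of signature `(2,1)` at `τ`, positive definite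
off the place of `τ`, anisotropic; `K` compact open with torsion-free conjugate arithmetic levels — the structure
`UnitaryCanonicalModel.ComplexRecord L H τ T hT K` is inhabited by the complex model `Mc := ∐_{q ∈ Ξ_K} X_q`, `X_q` the tree's
smooth projective ball quotient of the torsion-free congruence subgroup `Γ_q = U(H)(L⁺) ∩ g_qKg_q⁻¹` (module docstring for
the construction).  No named fact is used: the ball-quotient algebraisation is the tree's theorem
`BallQuotient.ballQuotientUniformisedDatum_holds`.  [Deligne1979ShimuraVarieties] 2.1.2 («a disjoint sum, indexed by
`G(ℚ)\G(𝔸^f)/K`, of the quotients `Γ_g\X⁺` … the structure of a quasi-projective algebraic variety [Baily–Borel]») for the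
datum `(Res_{L⁺/ℚ} U(H), h_{V,τ̄})`; [Milne2005ShimuraVarieties] Lemma 5.13.
[cite: Deligne1979ShimuraVarieties, 2.1.2 (PDF p. 24 L8–16 of Milne's translation)] [cite: Milne2005ShimuraVarieties, Lemma 5.13 p. 57]
[cite: BergeronMillsonMoeglin2016Balls, Introduction §1.1 and Part 2 §§1.1–1.4] -/
theorem nonempty_complexRecord
    (hpos : ∀ τ' : L →+* ℂ, InfinitePlace.mk τ' ≠ InfinitePlace.mk τ → (H.map τ').PosDef)
    (hanis : ∀ v : Fin 3 → L, hermForm (cmConjRingHom L) H v v = 0 → v = 0)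
    (K : Subgroup (finAdelic (↥(maximalRealSubfield L)) L (IsCMField.complexConj L) 3 H))
    (hKo : IsOpen (K : Set (finAdelic (↥(maximalRealSubfield L)) L (IsCMField.complexConj L) 3 H)))
    (hKc : IsCompact (K : Set (finAdelic (↥(maximalRealSubfield L)) L (IsCMField.complexConj L) 3 H)))
    (htf : ∀ g : finAdelic (↥(maximalRealSubfield L)) L (IsCMField.complexConj L) 3 H,
      ∀ γ ∈ arithmeticLevel (↥(maximalRealSubfield L)) L (IsCMField.complexConj L) 3 H
        (K.map (MulAut.conj g).toMonoidHom), IsOfFinOrder γ → γ = 1) :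
    Nonempty (ComplexRecord L H τ T hT K) := by
  classical
  have hH : ∀ i j, cmConjRingHom L (H i j) = H j i := hermitian_of_formCongr L H τ T hT
  have hJ := frame_J_of_formCongr L H τ T hT
  have hSig : ∃ T' : GL (Fin 3) ℂ,
      (T' : Matrix (Fin 3) (Fin 3) ℂ)ᴴ * H.map τ * (T' : Matrix (Fin 3) (Fin 3) ℂ) = signatureMatrix 2 :=
    ⟨T, by rw [UnitaryBallUniformisationDatum.signatureMatrix_two]; exact hJ⟩
  -- the finite index set `Ξ_K` and representatives `g_q`
  obtain ⟨g, hg⟩ := exists_representatives_finAdelic L H K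
  haveI hfin := finite_shimuraIndex L 3 H hanis K hKo
  -- the natural levels `Γ_q = U(H)(L⁺) ∩ g_qKg_q⁻¹`: torsion-free congruence subgroups of `U(H)(L⁺)`
  let Γq : orbitRel.Quotient (rational (↥(maximalRealSubfield L)) L (IsCMField.complexConj L) 3 H)
      (CosetSpace (rationalToFinAdelic (↥(maximalRealSubfield L)) L (IsCMField.complexConj L) 3 H) K) →
      Subgroup (GL (Fin 3) L) :=
    fun q => arithmeticLevel (↥(maximalRealSubfield L)) L (IsCMField.complexConj L) 3 H (K.map (MulAut.conj (g q)).toMonoidHom)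
  have hcong : ∀ q, IsCongruenceSubgroup (cmConjRingHom L) H (Γq q) := fun q =>
    isCongruenceSubgroup_arithmeticLevel_of_isOpen (isCompact_coe_map_conj hKc (g q)) (isOpen_coe_map_conj hKo (g q))
  have hΓrat : ∀ q, Γq q ≤ rational (↥(maximalRealSubfield L)) L (IsCMField.complexConj L) 3 H := by
    intro q γ hγ
    have h := (hcong q).1 hγ
    rw [unitaryGroup_eq_unitaryGroupOfForm] at h
    exact h
  -- the pieces: the tree's smooth projective ball quotients of the Picard codes `(τ(L), H^τ, τ(Γ_q))`
  let cd : orbitRel.Quotient (rational (↥(maximalRealSubfield L)) L (IsCMField.complexConj L) 3 H)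
      (CosetSpace (rationalToFinAdelic (↥(maximalRealSubfield L)) L (IsCMField.complexConj L) 3 H) K) → PicardCode :=
    fun q => PicardCode.ofHermitian τ H (Γq q) hH hSig hpos (hcong q) (htf (g q))
  have hcdan : ∀ q, (cd q).IsAnisotropic := fun q =>
    (PicardCode.isAnisotropic_ofHermitian_iff τ H (Γq q) hH hSig hpos (hcong q) (htf (g q))).mpr hanis
  let R := fun q => pmsRealisation BallQuotient.ballQuotientUniformisedDatum_holds (cd q)
  let X : orbitRel.Quotient (rational (↥(maximalRealSubfield L)) L (IsCMField.complexConj L) 3 H)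
      (CosetSpace (rationalToFinAdelic (↥(maximalRealSubfield L)) L (IsCMField.complexConj L) 3 H) K) → SchemeOver ℂ :=
    fun q => (R q).X
  let D : ∀ q, UnitaryBallUniformisationDatum 2 (X q) := fun q => (R q).datum (hcdan q)
  have hHc : ∀ q, (D q).Hℂ = H.map τ := fun q => by
    change ((R q).datum (hcdan q)).H.map ((R q).datum (hcdan q)).E.subtype = H.map τ
    rw [(R q).datum_H (hcdan q)]
    exact PicardCode.ofHermitian_H_map τ H (Γq q) hH hSig hpos (hcong q) (htf (g q))
  have hΓc : ∀ q, (D q).Γ.map (Matrix.GeneralLinearGroup.map ((D q).τ₁ : ↥(D q).E →+* ℂ)) =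
      (Γq q).map (Matrix.GeneralLinearGroup.map τ) := fun q => by
    change ((R q).datum (hcdan q)).Γ.map (Matrix.GeneralLinearGroup.map (((R q).datum (hcdan q)).E.subtype)) = _
    rw [(R q).datum_Γ (hcdan q)]
    exact PicardCode.ofHermitian_Γ_map τ H (Γq q) hH hSig hpos (hcong q) (htf (g q))
  -- the complex model `Mc := ∐_q X_q`, a colimit cofan in `SchemeOver ℂ`
  let Mc : SchemeOver ℂ := Over.mk (Sigma.desc fun q => (X q).hom)
  let ι : ∀ q, X q ⟶ Mc := fun q => Over.homMk (Sigma.ι (fun q => (X q).left) q) (Sigma.ι_desc _ _)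
  have hc : IsColimit (Cofan.mk Mc ι) :=
    isColimitOfIsColimitCofanMkObj (Over.forget _) _ _ (coproductIsCoproduct fun q => (X q).left)
  have hsm : SmoothOfRelativeDimension 2 Mc.hom :=
    Literature.AlgebraicGeometry.Motives.smoothOfRelativeDimension_of_isColimit_cofan hc
      fun q => (R q).isSmoothProjective.smoothOfRelativeDimension
  have hpr : IsProjectiveOver Mc :=
    Literature.AlgebraicGeometry.Motives.isProjectiveOver_of_isColimit_cofan hc fun q => (R q).isSmoothProjective.isProjectiveOver
  -- complex points: `Mc(ℂ) ≃ₜ ⨆_q X_q(ℂ) ≃ₜ ⨆_q Δ(Γ_q)\𝔹² ≃ₜ Sh_K(ℂ)`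
  obtain ⟨Φ, hΦ⟩ := Literature.AlgebraicGeometry.Motives.exists_sigmaHomeomorph_of_isColimit_cofan ℂ hc
  have hφ : ∀ q, ∃ φ : ComplexPoints (X q) ≃ₜ orbitRel.Quotient (archImageU21 L H τ T hT (Γq q)) Ball,
      ∀ z : Ball, φ.symm (Quotient.mk'' z) = (D q).unif ((T : Matrix (Fin 3) (Fin 3) ℂ) *ᵥ lift z) :=
    fun q => exists_pieceHomeomorph_of_datum L H τ T hT (hΓrat q) (D q) (hHc q) (hΓc q)
  choose φ hφ using hφ
  let pts : ComplexPoints Mc ≃ₜ ShimuraSet L H τ T hT K :=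
    Φ.symm.trans ((sigmaCongrRightHomeomorph φ).trans (shimuraSetHomeomorph L H τ T hT K hKo hg).symm)
  have hpts : ∀ q (z : Ball), pts.symm (ShimuraSet.mk L H τ T hT K z (g q)) =
      AlgPoints.map (ι q) ((D q).unif ((T : Matrix (Fin 3) (Fin 3) ℂ) *ᵥ lift z)) := by
    intro q z
    change Φ ((sigmaCongrRightHomeomorph φ).symm ((shimuraSetHomeomorph L H τ T hT K hKo hg).symm.symm
      (ShimuraSet.mk L H τ T hT K z (g q)))) = _
    rw [Homeomorph.symm_symm, shimuraSetHomeomorph_apply_mk]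
    change Φ ⟨q, (φ q).symm (Quotient.mk'' z)⟩ = _
    rw [hΦ, hφ]
  -- the uniformisation `z ↦ [z, aK]`: `[z, aK] = [ρ(γ)z, g_qK]` for a rational `γ`
  have hol : ∀ a : finAdelic (↥(maximalRealSubfield L)) L (IsCMField.complexConj L) 3 H,
      ∃ u : (Fin 3 → ℂ) → ComplexPoints Mc,
        (∀ x : Ball, u ((T : Matrix (Fin 3) (Fin 3) ℂ) *ᵥ lift x) = pts.symm (ShimuraSet.mk L H τ T hT K x a)) ∧
        (∀ v ∈ negCone (H.map τ), ∀ c : ℂ, c ≠ 0 → u (c • v) = u v) ∧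
        ∀ (U : Mc.left.affineOpens) (f : Mc.left.presheaf.obj (op (↑U : Mc.left.Opens))),
          DifferentiableOn ℂ (fun v ↦ AlgPoints.evalOrZero (↑U : Mc.left.Opens) f (u v))
            (negCone (H.map τ) ∩ u ⁻¹' {P | P.pt ∈ (↑U : Mc.left.Opens)}) := by
    intro a
    -- the class of `a` and a rational `γ` with `[z, aK] = [ρ(γ) z, g_qK]`
    let q : orbitRel.Quotient (rational (↥(maximalRealSubfield L)) L (IsCMField.complexConj L) 3 H)
        (CosetSpace (rationalToFinAdelic (↥(maximalRealSubfield L)) L (IsCMField.complexConj L) 3 H) K) :=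
      Quotient.mk'' (CosetSpace.pt (rationalToFinAdelic _ L _ 3 H) K a)
    have hqa : (MulAction.orbitRel (rational (↥(maximalRealSubfield L)) L (IsCMField.complexConj L) 3 H)
        (CosetSpace (rationalToFinAdelic (↥(maximalRealSubfield L)) L (IsCMField.complexConj L) 3 H) K))
        (CosetSpace.pt (rationalToFinAdelic _ L _ 3 H) K (g q)) (CosetSpace.pt (rationalToFinAdelic _ L _ 3 H) K a) :=
      Quotient.exact' (hg q)
    obtain ⟨γ, hγ⟩ := MulAction.orbitRel_apply.mp hqa
    -- `hγ : γ • pt a = pt (g q)`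
    have hmk : ∀ z : Ball, ShimuraSet.mk L H τ T hT K z a =
        ShimuraSet.mk L H τ T hT K (ratToU21 L H τ T hT γ • z) (g q) := by
      intro z
      rw [ShimuraSet.mk_eq_mk_iff]
      refine ⟨γ⁻¹, ?_, ?_⟩
      · rw [map_inv, inv_smul_smul]
      · have h1 : CosetSpace.pt (rationalToFinAdelic _ L _ 3 H) K
            (rationalToFinAdelic (↥(maximalRealSubfield L)) L (IsCMField.complexConj L) 3 H γ * a) =
            CosetSpace.pt (rationalToFinAdelic _ L _ 3 H) K (g q) := by
          rw [← CosetSpace.smul_pt]; exact hγ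
        rw [CosetSpace.pt_eq_pt_iff] at h1
        rw [map_inv]
        have : a⁻¹ * ((rationalToFinAdelic (↥(maximalRealSubfield L)) L (IsCMField.complexConj L) 3 H γ)⁻¹ * g q) =
            (rationalToFinAdelic (↥(maximalRealSubfield L)) L (IsCMField.complexConj L) 3 H γ * a)⁻¹ * g q := by
          rw [_root_.mul_inv_rev, mul_assoc]
        rw [this]
        exact h1
    -- the rational matrix `A = γ^τ` acting on the cone
    let A : Matrix (Fin 3) (Fin 3) ℂ := ((γ : GL (Fin 3) L) : Matrix (Fin 3) (Fin 3) L).map τ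
    have hA : ∀ v ∈ negCone (H.map τ), A *ᵥ v ∈ negCone (H.map τ) := fun v hv => map_mulVec_mem_negCone L H τ γ.2 hv
    have hAeq : A = ((Matrix.GeneralLinearGroup.map τ (γ : GL (Fin 3) L) : GL (Fin 3) ℂ) : Matrix (Fin 3) (Fin 3) ℂ) := by
      ext i j; rfl
    -- the datum's scalar invariance, on the cone of `H^τ`
    have hcone : (D q).cone = negCone (H.map τ) := congrArg negCone (hHc q)
    have hsmul : ∀ v ∈ negCone (H.map τ), ∀ c : ℂ, c ≠ 0 → (D q).unif (c • v) = (D q).unif v :=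
      fun v hv c hc => (D q).unif_smul hc (hcone ▸ hv)
    refine ⟨fun v => AlgPoints.map (ι q) ((D q).unif (A *ᵥ v)), fun x => ?_, fun v hv c hc => ?_, fun U f => ?_⟩
    · -- `u (T·(x,1)) = [x, aK]`
      obtain ⟨c, hc, hcx⟩ := mulVec_frame_lift_ratToU21_smul (hT := hT) γ x
      rw [hmk x, hpts q]
      change AlgPoints.map (ι q) ((D q).unif (A *ᵥ ((T : Matrix (Fin 3) (Fin 3) ℂ) *ᵥ lift x))) = _
      rw [hAeq, hcx, hsmul _ (t_mulVec_lift_mem T hJ _) c hc]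
    · -- homogeneity on the cone
      change AlgPoints.map (ι q) ((D q).unif (A *ᵥ (c • v))) = AlgPoints.map (ι q) ((D q).unif (A *ᵥ v))
      rw [mulVec_smul, hsmul _ (hA v hv) c hc]
    · -- holomorphy in the algebraic coordinates of `Mc`, from holomorphy on `X_q` along the open immersion `ι_q`
      let W : (X q).left.Opens := (ι q).left ⁻¹ᵁ (↑U : Mc.left.Opens)
      have hW : ∀ P : ComplexPoints (X q), (AlgPoints.map (ι q) P).pt ∈ (↑U : Mc.left.Opens) ↔ P.pt ∈ W :=
        fun P => Iff.rfl
      have hd := differentiableOn_evalOrZero_unif (D q) W ((ι q).left.app (↑U : Mc.left.Opens) f)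
      have hlin : Differentiable ℂ (fun v : Fin 3 → ℂ => A *ᵥ v) :=
        (Matrix.mulVecLin A).toContinuousLinearMap.differentiable
      have hcomp : DifferentiableOn ℂ
          (fun v : Fin 3 → ℂ => AlgPoints.evalOrZero W ((ι q).left.app (↑U : Mc.left.Opens) f) ((D q).unif (A *ᵥ v)))
          (negCone (H.map τ) ∩ (fun v => AlgPoints.map (ι q) ((D q).unif (A *ᵥ v))) ⁻¹'
            {P | P.pt ∈ (↑U : Mc.left.Opens)}) := by
        refine hd.comp hlin.differentiableOn ?_
        rintro v ⟨hv, hvU⟩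
        exact ⟨hcone ▸ hA v hv, (hW _).mp hvU⟩
      refine hcomp.congr ?_
      rintro v -
      exact AlgPoints.evalOrZero_map (ι q) (↑U : Mc.left.Opens) f ((D q).unif (A *ᵥ v))
  refine ⟨{ Mc := Mc, smooth := hsm, projective := hpr, pts := pts, hol := hol, pieces := ?_ }⟩
  exact ⟨g, hg, X, ι, hc, D, fun q => ⟨hHc q, hΓc q, fun x => (hpts q x).symm⟩⟩

end Summit.HodgeConjecture.CorCM.HComp

end
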